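import Literature.NumberTheory.EllipticCurves.GlobalMinimalModel
import Mathlib.RingTheory.DedekindDomain.FiniteAdeleRing

/-!
# Proof: global minimal models over number fields of class number one

Discharge of the named fact `WeierstrassCurve.hasGlobalMinimalModel_of_isPrincipalIdealRing`
(Silverman, *The Arithmetic of Elliptic Curves*, 2nd ed., VIII.8, Cor. 8.3, p. 213): over a
number field `K` with `𝓞 K` a principal ideal ring, every elliptic Weierstrass equation over `K`
admits a `K`-isomorphic equation which is integral over `𝓞 K` and minimal at every finite place,
in the sense of `WeierstrassCurve.IsGloballyMinimal` (minimality of the base change to `K_v` with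
respect to `𝓞_{K_v}`, Mathlib's `WeierstrassCurve.IsMinimal`). As corollaries,
`hasGlobalMinimalModel_rat` (`𝓞 ℚ ≃ ℤ` is a PID) and `minimalDiscriminantInt_smul_eq` (from
`isGloballyMinimal_unique_holds` of `GlobalMinimalModel.lean`).

## Proof

We follow the proof of Silverman VIII.8.2 (pp. 211–213) but treat one prime at a time, which
avoids the Chinese remainder theorem and VII.1.3(d):

* (`IsMinimal.smul_baseChange`, `isMinimal_of_valuation_Δ_eq_one`) over a DVR `R`, a change of
  variables defined over `R` preserves integrality and minimality, and an integral equation with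
  unit discriminant is minimal (Silverman VII.1, Remark 1.1);
* (`finite_setOf_not_isMinimalAt`) hence a Weierstrass equation with `Δ ≠ 0` is minimal at all
  but finitely many places (the set `S` of *loc. cit.*);
* (`exists_variableChange_isMinimalAt`, the local step) given `v`, take a local minimal model
  `C_v • W_{K_v}` (Mathlib's `exists_isMinimal`), a generator `g` of the prime `v` (this is where
  `IsPrincipalIdealRing (𝓞 K)` enters: `g` is a `w`-unit for all `w ≠ v`), `u := g^{-ord u_v}`,
  and `r, s, t ∈ K` integral away from `v` and `v`-adically close to `r_v, s_v, t_v`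
  (`exists_approx_integral_away`: density of `K` in `K_v` plus
  `IsDedekindDomain.HeightOneSpectrum.exists_valuation_sub_lt_of_integer`). Then
  `[u, r, s, t] • W` differs from the local minimal model by a change of variables defined over
  `𝓞_{K_v}` (the ultrametric estimate of *loc. cit.*, p. 212), so it is minimal at `v`, and it is
  still minimal wherever `W` was (`isMinimal_adicCompletion_smul`);
* (`exists_variableChange_forall_isMinimalAt`) induction on the finite bad set;
* integrality over `𝓞 K` follows from integrality at every `v`
  (`IsDedekindDomain.HeightOneSpectrum.mem_integers_of_valuation_le_one`).

## References

* J. H. Silverman, *The Arithmetic of Elliptic Curves*, GTM 106, 2nd ed. (2009), VII.1, VIII.8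
  (Prop. 8.2 pp. 211–213, Cor. 8.3 p. 213). [cite: SilvermanAEC2009]
-/

noncomputable section

open scoped Classical WithZero
open NumberField IsDedekindDomain

namespace WeierstrassCurve

/-! ### Local lemmas over a discrete valuation ring -/

section DVR

variable {R : Type*} [CommRing R] [IsDomain R] [IsDiscreteValuationRing R]
variable {K : Type*} [Field K] [Algebra R K] [IsFractionRing R K]

open IsDiscreteValuationRing IsDedekindDomain.HeightOneSpectrum

omit [IsDomain R] [IsDiscreteValuationRing R] [IsFractionRing R K] in
/-- An `R`-integral change of variables preserves integrality. [folklore] -/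
theorem IsIntegral.smul_baseChange (W : WeierstrassCurve K) [IsIntegral R W]
    (D : VariableChange R) : IsIntegral R (D.baseChange K • W) := by
  refine ⟨⟨D • integralModel R W, ?_⟩⟩
  rw [baseChange, ← map_variableChange, ← baseChange, baseChange_integralModel_eq]
  rfl

/-- The discriminant valuation is unchanged by an `R`-integral change of variables. [folklore] -/
theorem valuation_Δ_smul_baseChange (W : WeierstrassCurve K) (D : VariableChange R) :
    valuation K (maximalIdeal R) (D.baseChange K • W).Δ = valuation K (maximalIdeal R) W.Δ := by
  rw [variableChange_Δ, map_mul, map_pow]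
  have hu : valuation K (maximalIdeal R) ((D.baseChange K).u⁻¹ : Kˣ) = 1 := by
    have h1 : valuation K (maximalIdeal R) (algebraMap R K (D.u⁻¹ : Rˣ)) = 1 := by
      rw [valuation_of_algebraMap]
      exact intValuation_eq_one_iff.mpr fun h =>
        (maximalIdeal R).isPrime.ne_top (Ideal.eq_top_of_isUnit_mem _ h (Units.isUnit _))
    simpa [VariableChange.baseChange, VariableChange.map] using h1
  rw [hu, one_pow, one_mul]

/-- `valuation_Δ_aux` is unchanged by an `R`-integral change of variables. [folklore] -/
theorem valuation_Δ_aux_smul_baseChange (W : WeierstrassCurve K) [IsIntegral R W]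
    (D : VariableChange R) :
    haveI := IsIntegral.smul_baseChange W D
    valuation_Δ_aux R (D.baseChange K • W) = valuation_Δ_aux R W := by
  haveI := IsIntegral.smul_baseChange W D
  apply Subtype.ext
  rw [valuation_Δ_aux_eq_of_isIntegral, valuation_Δ_aux_eq_of_isIntegral,
    valuation_Δ_smul_baseChange]

/-- An `R`-integral change of variables preserves minimality. [folklore] -/
theorem IsMinimal.smul_baseChange (W : WeierstrassCurve K) [hW : IsMinimal R W]
    (D : VariableChange R) : IsMinimal R (D.baseChange K • W) := by
  refine ⟨⟨by simpa using IsIntegral.smul_baseChange W D, ?_⟩⟩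
  intro C hC hle
  simp only [smul_smul] at hC hle ⊢
  have h₁ := hW.val_Δ_maximal.2 hC
  simp only [one_smul, one_mul] at h₁ hle ⊢
  rw [valuation_Δ_aux_smul_baseChange]
  apply h₁
  rw [← valuation_Δ_aux_smul_baseChange W D]
  exact hle

/-- An integral Weierstrass equation whose discriminant is a unit is minimal. [folklore] -/
theorem isMinimal_of_valuation_Δ_eq_one (W : WeierstrassCurve K) [hW : IsIntegral R W]
    (hΔ : valuation K (maximalIdeal R) W.Δ = 1) : IsMinimal R W := by
  refine ⟨⟨by simpa using hW, ?_⟩⟩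
  intro C _ _
  have h1 : (valuation_Δ_aux R ((1 : VariableChange K) • W) : ℤᵐ⁰) = 1 := by
    simp only [one_smul]
    rw [valuation_Δ_aux_eq_of_isIntegral, hΔ]
  change (valuation_Δ_aux R (C • W) : ℤᵐ⁰) ≤
    valuation_Δ_aux R ((1 : VariableChange K) • W)
  rw [h1]
  exact (valuation_Δ_aux R (C • W)).2

omit [IsDomain R] [IsDiscreteValuationRing R] [IsFractionRing R K] in
/-- A change of variables over `K` whose data lie in (the image of) `R`, with `u` a unit of `R`,
comes from a change of variables over `R`. [folklore] -/
theorem VariableChange.exists_baseChange_eq (D : VariableChange K) (u₀ : Rˣ)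
    (hu : algebraMap R K u₀ = D.u) (hr : D.r ∈ (algebraMap R K).range)
    (hs : D.s ∈ (algebraMap R K).range) (ht : D.t ∈ (algebraMap R K).range) :
    ∃ D₀ : VariableChange R, D₀.baseChange K = D := by
  obtain ⟨r, hr⟩ := hr
  obtain ⟨s, hs⟩ := hs
  obtain ⟨t, ht⟩ := ht
  refine ⟨⟨u₀, r, s, t⟩, ?_⟩
  ext
  · simpa [VariableChange.baseChange, VariableChange.map] using hu
  · simpa [VariableChange.baseChange, VariableChange.map] using hr
  · simpa [VariableChange.baseChange, VariableChange.map] using hs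
  · simpa [VariableChange.baseChange, VariableChange.map] using ht

omit [IsDomain R] [IsDiscreteValuationRing R] [IsFractionRing R K] in
/-- The coefficients of an integral Weierstrass equation lie in the image of `R`. [folklore] -/
theorem IsIntegral.a_mem_range (W : WeierstrassCurve K) [hW : IsIntegral R W] :
    W.a₁ ∈ (algebraMap R K).range ∧ W.a₂ ∈ (algebraMap R K).range ∧
      W.a₃ ∈ (algebraMap R K).range ∧ W.a₄ ∈ (algebraMap R K).range ∧
      W.a₆ ∈ (algebraMap R K).range := by
  obtain ⟨W₀, h⟩ := hW.integral
  subst h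
  exact ⟨⟨W₀.a₁, rfl⟩, ⟨W₀.a₂, rfl⟩, ⟨W₀.a₃, rfl⟩, ⟨W₀.a₄, rfl⟩,
    ⟨W₀.a₆, rfl⟩⟩

end DVR

end WeierstrassCurve

/-! ### Global lemmas over a Dedekind domain / PID -/

namespace IsDedekindDomain.HeightOneSpectrum

open WithZero

variable {R : Type*} [CommRing R] [IsDedekindDomain R]
variable {K : Type*} [Field K] [Algebra R K] [IsFractionRing R K]

/-- In a principal ideal domain every nonzero prime has a generator which is a unit at all
other primes. [folklore] -/
theorem exists_generator_intValuation [IsPrincipalIdealRing R] (v : HeightOneSpectrum R) :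
    ∃ g : R, g ≠ 0 ∧ v.intValuation g = exp (-1 : ℤ) ∧
      ∀ w : HeightOneSpectrum R, w ≠ v → w.intValuation g = 1 := by
  obtain ⟨g, hg⟩ := (IsPrincipalIdealRing.principal v.asIdeal).principal
  have hg' : v.asIdeal = Ideal.span {g} := hg
  have hg0 : g ≠ 0 := by
    rintro rfl
    apply v.ne_bot
    rw [hg']
    simp
  refine ⟨g, hg0, v.intValuation_singleton hg0 hg', fun w hw => ?_⟩
  rw [intValuation_eq_one_iff]
  intro hmem
  apply hw
  have hle : v.asIdeal ≤ w.asIdeal := by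
    rw [hg', Ideal.span_singleton_le_iff_mem]
    exact hmem
  exact HeightOneSpectrum.ext (v.isMaximal.eq_of_le w.isPrime.ne_top hle).symm

/-- In a principal ideal domain there are global elements with prescribed valuation at one prime
which are units at all other primes. [folklore] -/
theorem exists_valuation_eq_exp [IsPrincipalIdealRing R] (v : HeightOneSpectrum R) (k : ℤ) :
    ∃ u : K, u ≠ 0 ∧ v.valuation K u = exp k ∧
      ∀ w : HeightOneSpectrum R, w ≠ v → w.valuation K u = 1 := by
  obtain ⟨g, hg0, hgv, hgw⟩ := v.exists_generator_intValuation
  have hg0' : (algebraMap R K g) ≠ 0 :=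
    fun h => hg0 ((injective_iff_map_eq_zero _).mp (IsFractionRing.injective R K) g h)
  refine ⟨(algebraMap R K g) ^ (-k), zpow_ne_zero _ hg0', ?_, fun w hw => ?_⟩
  · rw [map_zpow₀, valuation_of_algebraMap, hgv, ← exp_zsmul]
    congr 1
    ring
  · rw [map_zpow₀, valuation_of_algebraMap, hgw w hw, one_zpow]

/-- The valuation on `K_v` restricted to `K` along `algebraMap` is the `v`-adic valuation.
[folklore] -/
theorem valued_algebraMap (v : HeightOneSpectrum R) (k : K) :
    Valued.v (algebraMap K (v.adicCompletion K) k) = v.valuation K k := by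
  rw [algebraMap_adicCompletion]
  simp

/-- Weak approximation with integrality away from one prime (PID case): every element of `K_v`
is approximated arbitrarily well by elements of `K` that are integral at all primes `w ≠ v`.
[folklore] -/
theorem exists_approx_integral_away [IsPrincipalIdealRing R] (v : HeightOneSpectrum R)
    (y : v.adicCompletion K) {δ : ℤᵐ⁰} (hδ : δ ≠ 0) :
    ∃ r : K, Valued.v (algebraMap K (v.adicCompletion K) r - y) < δ ∧
      ∀ w : HeightOneSpectrum R, w ≠ v → w.valuation K r ≤ 1 := by
  obtain ⟨g, hg0, hgv, hgw⟩ := v.exists_generator_intValuation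
  set ι := algebraMap K (v.adicCompletion K) with hι
  set gK : K := algebraMap R K g with hgK_def
  have hg0' : gK ≠ 0 :=
    fun h => hg0 ((injective_iff_map_eq_zero _).mp (IsFractionRing.injective R K) g h)
  have hgK : Valued.v (ι gK) = exp (-1 : ℤ) := by
    rw [valued_algebraMap, hgK_def, valuation_of_algebraMap, hgv]
  -- Step 1: scale `y` into the local integers.
  obtain ⟨N, hN⟩ : ∃ N : ℕ, Valued.v (ι gK ^ N * y) ≤ 1 := by
    by_cases hy : y = 0
    · exact ⟨0, by simp [hy]⟩
    · have hy' : Valued.v y ≠ 0 := (Valuation.ne_zero_iff _).mpr hy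
      set m : ℤ := log (Valued.v y) with hm
      have hym : Valued.v y = exp m := (exp_log hy').symm
      refine ⟨m.toNat, ?_⟩
      rw [map_mul, map_pow, hgK, hym, ← exp_nsmul, ← exp_add, ← exp_zero, exp_le_exp]
      have := Int.self_le_toNat m
      simp only [smul_neg, nsmul_eq_mul, mul_one]
      omega
  set z := ι gK ^ N * y with hz
  -- Step 2: the target radius.
  set ε : ℤᵐ⁰ := min (δ * exp (-(N : ℤ))) 1 with hε
  have hε0 : ε ≠ 0 := by
    rcases min_choice (δ * exp (-(N : ℤ))) 1 with h | h <;> rw [hε, h] <;> simp [hδ]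
  have hε1 : ε ≤ 1 := min_le_right _ _
  have hεδ : ε ≤ δ * exp (-(N : ℤ)) := min_le_left _ _
  -- Step 3: approximate `z` by an element of `K` (density), then by an element of `R`.
  obtain ⟨c, hc⟩ := valuedAdicCompletion_surjective K v ε
  have hc0 : Valued.v c ≠ 0 := hc ▸ hε0
  have hS : {z' : v.adicCompletion K | Valued.v (z' - z) < Valued.v c} ∈ nhds z := by
    rw [Valued.mem_nhds]
    refine ⟨Units.mk0 (Valued.v.restrict c) (by simpa using hc0), fun y hy => ?_⟩
    simp only [Set.mem_setOf_eq, Units.val_mk0] at hy ⊢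
    exact (Valuation.restrict_lt_iff _).mp hy
  obtain ⟨x, hx⟩ := (denseRange_algebraMap K v).mem_nhds hS
  simp only [Set.mem_setOf_eq, hc] at hx
  have hx1 : v.valuation K x ≤ 1 := by
    rw [← valued_algebraMap]
    have : ι x = (ι x - z) + z := by ring
    rw [this]
    exact (Valuation.map_add _ _ _).trans (max_le (hx.le.trans hε1) hN)
  obtain ⟨a, ha⟩ := exists_valuation_sub_lt_of_integer v hx1 (Units.mk0 ε hε0)
  rw [Units.val_mk0] at ha
  have haz : Valued.v (ι (algebraMap R K a) - z) < ε := by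
    have : ι (algebraMap R K a) - z = ι (algebraMap R K a - x) + (ι x - z) := by
      rw [map_sub]; ring
    rw [this]
    refine lt_of_le_of_lt (Valuation.map_add _ _ _) (max_lt ?_ hx)
    rwa [valued_algebraMap]
  -- Step 4: unscale.
  refine ⟨gK ^ (-(N : ℤ)) * algebraMap R K a, ?_, fun w hw => ?_⟩
  · have : ι (gK ^ (-(N : ℤ)) * algebraMap R K a) - y =
        ι gK ^ (-(N : ℤ)) * (ι (algebraMap R K a) - z) := by
      rw [hz, map_mul, map_zpow₀, mul_sub, ← mul_assoc, zpow_neg, zpow_natCast,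
        inv_mul_cancel₀ (pow_ne_zero _ (by rw [map_ne_zero]; exact hg0')), one_mul]
    rw [this, map_mul, map_zpow₀, hgK, ← exp_zsmul,
      show (-(N : ℤ)) • (-1 : ℤ) = N by simp]
    calc exp (N : ℤ) * Valued.v (ι (algebraMap R K a) - z)
        < exp (N : ℤ) * ε := by gcongr; exact exp_pos
      _ ≤ exp (N : ℤ) * (δ * exp (-(N : ℤ))) := by gcongr
      _ = δ := by rw [mul_comm, mul_assoc, ← exp_add]; simp
  · rw [map_mul, map_zpow₀, hgK_def, valuation_of_algebraMap, hgw w hw, one_zpow, one_mul,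
      valuation_of_algebraMap]
    exact w.intValuation_le_one a

end IsDedekindDomain.HeightOneSpectrum

namespace WeierstrassCurve

/-! ### Minimality at a place, the local step, and the induction -/

section Global

open IsDedekindDomain.HeightOneSpectrum WithZero

variable {R : Type*} [CommRing R] [IsDedekindDomain R]
variable {K : Type*} [Field K] [Algebra R K] [IsFractionRing R K]

/-- Base change commutes with changes of variables. [folklore] -/
theorem baseChange_smul_eq {A : Type*} [CommRing A] [Algebra K A] (C : VariableChange K)
    (W : WeierstrassCurve K) :
    (C • W).baseChange A = C.baseChange A • W.baseChange A := by
  rw [baseChange, ← map_variableChange]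
  rfl

/-- The image of `𝓞_{K_v} → K_v` is the closed unit ball. [folklore] -/
theorem algebraMap_adicCompletionIntegers_range_iff (v : HeightOneSpectrum R)
    (x : v.adicCompletion K) :
    x ∈ (algebraMap (v.adicCompletionIntegers K) (v.adicCompletion K)).range ↔
      Valued.v x ≤ 1 := by
  constructor
  · rintro ⟨y, rfl⟩
    exact y.2
  · intro hx
    exact ⟨⟨x, hx⟩, rfl⟩

/-- Elements of valuation one have valuation one for the intrinsic valuation of the DVR
`𝓞_{K_v}`. [folklore] -/
theorem valuation_maximalIdeal_eq_one (v : HeightOneSpectrum R) {x : v.adicCompletion K}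
    (hx : Valued.v x = 1) :
    valuation (v.adicCompletion K)
      (IsDiscreteValuationRing.maximalIdeal (v.adicCompletionIntegers K)) x = 1 := by
  have : x = algebraMap (v.adicCompletionIntegers K) (v.adicCompletion K) ⟨x, hx.le⟩ := rfl
  rw [this, valuation_of_algebraMap, intValuation_eq_one_iff]
  change (⟨x, hx.le⟩ : v.adicCompletionIntegers K) ∉ IsLocalRing.maximalIdeal _
  rw [IsLocalRing.mem_maximalIdeal, mem_nonunits_iff, not_not,
    adicCompletionIntegers.isUnit_iff_valued_eq_one]
  exact hx

/-- A change of variables over `K_v` with `v`-unit `u` and `v`-integral `r, s, t` descends to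
`𝓞_{K_v}`. [folklore] -/
theorem VariableChange.exists_baseChange_adicCompletion (v : HeightOneSpectrum R)
    (D : VariableChange (v.adicCompletion K)) (hu : Valued.v (D.u : v.adicCompletion K) = 1)
    (hr : Valued.v D.r ≤ 1) (hs : Valued.v D.s ≤ 1) (ht : Valued.v D.t ≤ 1) :
    ∃ D₀ : VariableChange (v.adicCompletionIntegers K),
      D₀.baseChange (v.adicCompletion K) = D := by
  have hunit : IsUnit (⟨(D.u : v.adicCompletion K), hu.le⟩ : v.adicCompletionIntegers K) :=
    adicCompletionIntegers.isUnit_iff_valued_eq_one.mpr hu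
  refine VariableChange.exists_baseChange_eq D hunit.unit rfl ?_ ?_ ?_
  · exact (algebraMap_adicCompletionIntegers_range_iff v _).mpr hr
  · exact (algebraMap_adicCompletionIntegers_range_iff v _).mpr hs
  · exact (algebraMap_adicCompletionIntegers_range_iff v _).mpr ht

/-- A change of variables over `K` with `w`-unit `u` and `w`-integral `r, s, t` preserves
minimality at `w`. [folklore] -/
theorem isMinimal_adicCompletion_smul {W : WeierstrassCurve K} {w : HeightOneSpectrum R}
    (hW : (W.baseChange (w.adicCompletion K)).IsMinimal (w.adicCompletionIntegers K))
    (C : VariableChange K) (hu : w.valuation K (C.u : K) = 1)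
    (hr : w.valuation K C.r ≤ 1)
    (hs : w.valuation K C.s ≤ 1) (ht : w.valuation K C.t ≤ 1) :
    ((C • W).baseChange (w.adicCompletion K)).IsMinimal (w.adicCompletionIntegers K) := by
  obtain ⟨D₀, hD₀⟩ := VariableChange.exists_baseChange_adicCompletion w
    (C.baseChange (w.adicCompletion K))
    (by simpa [VariableChange.baseChange, VariableChange.map, valued_algebraMap] using hu)
    (by simpa [VariableChange.baseChange, VariableChange.map, valued_algebraMap] using hr)
    (by simpa [VariableChange.baseChange, VariableChange.map, valued_algebraMap] using hs)
    (by simpa [VariableChange.baseChange, VariableChange.map, valued_algebraMap] using ht)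
  rw [baseChange_smul_eq, ← hD₀]
  exact IsMinimal.smul_baseChange _ D₀

/-- An equation which is `v`-integral with `v`-unit discriminant is minimal at `v`
(Silverman, *AEC* VII.1, Remark 1.1). [cite: SilvermanAEC2009, VII.1, Remark 1.1] -/
theorem isMinimalAt_of_valuation (W : WeierstrassCurve K) (v : HeightOneSpectrum R)
    (h₁ : v.valuation K W.a₁ ≤ 1) (h₂ : v.valuation K W.a₂ ≤ 1)
    (h₃ : v.valuation K W.a₃ ≤ 1) (h₄ : v.valuation K W.a₄ ≤ 1)
    (h₆ : v.valuation K W.a₆ ≤ 1) (hΔ : v.valuation K W.Δ = 1) :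
    (W.baseChange (v.adicCompletion K)).IsMinimal (v.adicCompletionIntegers K) := by
  haveI : IsIntegral (v.adicCompletionIntegers K) (W.baseChange (v.adicCompletion K)) := by
    apply isIntegral_of_exists_lift
    all_goals
      apply (RingHom.mem_range).mp
      apply (algebraMap_adicCompletionIntegers_range_iff v _).mpr
      simpa [baseChange, valued_algebraMap]
  apply isMinimal_of_valuation_Δ_eq_one
  apply valuation_maximalIdeal_eq_one
  simpa [baseChange, valued_algebraMap] using hΔ

/-- The set of finite places at which a Weierstrass equation with nonzero discriminant fails to
be minimal is finite (Silverman, *AEC* VIII.8, proof of Prop. 8.2: `S` is finite).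
[cite: SilvermanAEC2009, VIII.8, proof of Prop. 8.2, p. 212] -/
theorem finite_setOf_not_isMinimalAt (W : WeierstrassCurve K) (hΔ : W.Δ ≠ 0) :
    {v : HeightOneSpectrum R |
      ¬ (W.baseChange (v.adicCompletion K)).IsMinimal (v.adicCompletionIntegers K)}.Finite := by
  refine Set.Finite.subset ((((((Support.finite R W.a₁).union (Support.finite R W.a₂)).union
    (Support.finite R W.a₃)).union (Support.finite R W.a₄)).union
    (Support.finite R W.a₆)).union (Support.finite R W.Δ⁻¹)) ?_
  intro v hv
  by_contra h
  simp only [Set.mem_union, Support, Set.mem_setOf_eq, not_or, not_lt] at h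
  obtain ⟨⟨⟨⟨⟨h₁, h₂⟩, h₃⟩, h₄⟩, h₆⟩, hΔ'⟩ := h
  apply hv
  apply isMinimalAt_of_valuation W v h₁ h₂ h₃ h₄ h₆
  apply le_antisymm
  · have hint : IsIntegral (v.adicCompletionIntegers K)
        (W.baseChange (v.adicCompletion K)) := by
      apply isIntegral_of_exists_lift
      all_goals
        apply (RingHom.mem_range).mp
        apply (algebraMap_adicCompletionIntegers_range_iff v _).mpr
        simpa [baseChange, valued_algebraMap]
    obtain ⟨d, hd⟩ := Δ_integral_of_isIntegral (v.adicCompletionIntegers K)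
      (W.baseChange (v.adicCompletion K))
    have : Valued.v (W.baseChange (v.adicCompletion K)).Δ ≤ 1 := hd ▸ d.2
    simpa [baseChange, valued_algebraMap] using this
  · rw [map_inv₀] at hΔ'
    have h0 : v.valuation K W.Δ ≠ 0 := (Valuation.ne_zero_iff _).mpr hΔ
    exact (inv_le_one₀ (zero_lt_iff.mpr h0)).mp hΔ'

/-- **Local step** (Silverman, *AEC* VIII.8, proof of Prop. 8.2, one prime at a time): over a PID,
for every finite place `v` there is a change of variables over `K`, with `u` a `w`-unit and
`r, s, t` `w`-integral for all `w ≠ v`, making the equation minimal at `v`.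
[cite: SilvermanAEC2009, VIII.8, proof of Prop. 8.2, p. 212] -/
theorem exists_variableChange_isMinimalAt [IsPrincipalIdealRing R] (W : WeierstrassCurve K)
    (v : HeightOneSpectrum R) :
    ∃ C : VariableChange K,
      ((C • W).baseChange (v.adicCompletion K)).IsMinimal (v.adicCompletionIntegers K) ∧
      ∀ w : HeightOneSpectrum R, w ≠ v →
        w.valuation K (C.u : K) = 1 ∧ w.valuation K C.r ≤ 1 ∧ w.valuation K C.s ≤ 1 ∧
          w.valuation K C.t ≤ 1 := by
  obtain ⟨ι, hι⟩ : ∃ ι : K →+* v.adicCompletion K, ι = algebraMap K _ := ⟨_, rfl⟩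
  have hιv : ∀ x : K, Valued.v (ι x) = v.valuation K x := fun x => by
    rw [hι, valued_algebraMap]
  -- a local minimal model
  obtain ⟨Cv, hCv⟩ :=
    exists_isMinimal (v.adicCompletionIntegers K) (W.baseChange (v.adicCompletion K))
  set W₀ := Cv • W.baseChange (v.adicCompletion K) with hW₀
  have ha0 : Valued.v Cv.u.val ≠ 0 := (Valuation.ne_zero_iff _).mpr Cv.u.ne_zero
  set a : ℤᵐ⁰ := Valued.v Cv.u.val with ha
  have hak : a = exp (log a) := (exp_log ha0).symm
  -- the global `u`
  obtain ⟨u, hu0, huv, huw⟩ := v.exists_valuation_eq_exp (K := K) (log a)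
  have hιu : Valued.v (ι u) = a := by rw [hιv, huv, ← hak]
  -- radii, and the global `r, s, t`
  set b : ℤᵐ⁰ := max (Valued.v Cv.s) 1 with hb
  have hb0 : b ≠ 0 := ne_of_gt (lt_of_lt_of_le one_pos (le_max_right _ _))
  have hδr : min (a ^ 2) (a ^ 3 / b) ≠ 0 := by
    rcases min_choice (a ^ 2) (a ^ 3 / b) with h | h <;> rw [h]
    · exact pow_ne_zero _ ha0
    · exact div_ne_zero (pow_ne_zero _ ha0) hb0
  obtain ⟨r, hr, hrw⟩ := v.exists_approx_integral_away (K := K) Cv.r hδr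
  obtain ⟨s, hs, hsw⟩ := v.exists_approx_integral_away (K := K) Cv.s ha0
  obtain ⟨t, ht, htw⟩ := v.exists_approx_integral_away (K := K) Cv.t (pow_ne_zero 3 ha0)
  rw [← hι] at hr hs ht
  have hr2 : Valued.v (ι r - Cv.r) ≤ a ^ 2 := (lt_of_lt_of_le hr (min_le_left _ _)).le
  have hr3 : Valued.v Cv.s * Valued.v (ι r - Cv.r) ≤ a ^ 3 :=
    calc Valued.v Cv.s * Valued.v (ι r - Cv.r) ≤ b * (a ^ 3 / b) :=
          mul_le_mul' (le_max_left _ _) (lt_of_lt_of_le hr (min_le_right _ _)).le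
      _ = a ^ 3 := mul_div_cancel₀ _ hb0
  -- the global change of variables `C`; `D` compares it with the local one
  let C : VariableChange K := ⟨Units.mk0 u hu0, r, s, t⟩
  refine ⟨C, ?_, fun w hw => ⟨huw w hw, hrw w hw, hsw w hw, htw w hw⟩⟩
  set D := C.baseChange (v.adicCompletion K) * Cv⁻¹ with hD
  have hDu : D.u.val = ι u * Cv.u.val⁻¹ := by
    simp [hD, C, VariableChange.mul_def, VariableChange.inv_def, VariableChange.baseChange,
      VariableChange.map, hι]
  have hDr : D.r = (ι r - Cv.r) * Cv.u.val⁻¹ ^ 2 := by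
    simp only [hD, C, VariableChange.mul_def, VariableChange.inv_def, VariableChange.baseChange,
      VariableChange.map, hι, Units.val_inv_eq_inv_val]
    ring
  have hDs : D.s = (ι s - Cv.s) * Cv.u.val⁻¹ := by
    simp only [hD, C, VariableChange.mul_def, VariableChange.inv_def, VariableChange.baseChange,
      VariableChange.map, hι, Units.val_inv_eq_inv_val]
    ring
  have hDt : D.t = ((ι t - Cv.t) - Cv.s * (ι r - Cv.r)) * Cv.u.val⁻¹ ^ 3 := by
    simp only [hD, C, VariableChange.mul_def, VariableChange.inv_def, VariableChange.baseChange,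
      VariableChange.map, hι, Units.val_inv_eq_inv_val]
    ring
  -- `D` is `v`-integral with `v`-unit `u`, hence descends to `𝓞_{K_v}`
  obtain ⟨D₀, hD₀⟩ := VariableChange.exists_baseChange_adicCompletion v D
    (by rw [hDu, map_mul, map_inv₀, hιu, ha, mul_inv_cancel₀ ha0])
    (by
      rw [hDr, map_mul, map_pow, map_inv₀, ← ha]
      calc Valued.v (ι r - Cv.r) * a⁻¹ ^ 2 ≤ a ^ 2 * a⁻¹ ^ 2 := mul_le_mul_left hr2 _
        _ = 1 := by rw [inv_pow, mul_inv_cancel₀ (pow_ne_zero _ ha0)])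
    (by
      rw [hDs, map_mul, map_inv₀, ← ha]
      calc Valued.v (ι s - Cv.s) * a⁻¹ ≤ a * a⁻¹ := mul_le_mul_left hs.le _
        _ = 1 := by rw [mul_inv_cancel₀ ha0])
    (by
      rw [hDt, map_mul, map_pow, map_inv₀, ← ha]
      calc Valued.v ((ι t - Cv.t) - Cv.s * (ι r - Cv.r)) * a⁻¹ ^ 3 ≤ a ^ 3 * a⁻¹ ^ 3 := by
            refine mul_le_mul_left ((Valuation.map_sub _ _ _).trans (max_le ht.le ?_)) _
            rwa [map_mul]
        _ = 1 := by rw [inv_pow, mul_inv_cancel₀ (pow_ne_zero _ ha0)])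
  -- conclude
  have key : (C • W).baseChange (v.adicCompletion K) =
      D₀.baseChange (v.adicCompletion K) • W₀ := by
    rw [baseChange_smul_eq, hD₀, hW₀, smul_smul, hD, inv_mul_cancel_right]
  rw [key]
  exact IsMinimal.smul_baseChange W₀ D₀

/-- **Induction over the bad places**: if the non-minimal places of `W` lie in a finite set, some
`K`-isomorphic equation is minimal at every finite place (PID case).
[cite: SilvermanAEC2009, VIII.8, proof of Prop. 8.2, p. 212] -/
theorem exists_variableChange_forall_isMinimalAt [IsPrincipalIdealRing R]
    (s : Finset (HeightOneSpectrum R)) :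
    ∀ W : WeierstrassCurve K, {v : HeightOneSpectrum R |
        ¬ (W.baseChange (v.adicCompletion K)).IsMinimal (v.adicCompletionIntegers K)} ⊆ ↑s →
      ∃ C : VariableChange K, ∀ v : HeightOneSpectrum R,
        ((C • W).baseChange (v.adicCompletion K)).IsMinimal (v.adicCompletionIntegers K) := by
  induction s using Finset.induction_on with
  | empty =>
    intro W hW
    refine ⟨1, fun v => ?_⟩
    rw [one_smul]
    by_contra h
    simpa using hW h
  | insert v s hv ih =>
    intro W hW
    obtain ⟨C₁, hC₁v, hC₁w⟩ := exists_variableChange_isMinimalAt W v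
    have hsub : {w : HeightOneSpectrum R |
        ¬ ((C₁ • W).baseChange (w.adicCompletion K)).IsMinimal (w.adicCompletionIntegers K)} ⊆
        ↑s := by
      intro w hw
      have hwv : w ≠ v := by
        rintro rfl
        exact hw hC₁v
      have hwW :
          ¬ (W.baseChange (w.adicCompletion K)).IsMinimal (w.adicCompletionIntegers K) := by
        intro hmin
        obtain ⟨hu, hr, hs, ht⟩ := hC₁w w hwv
        exact hw (isMinimal_adicCompletion_smul hmin C₁ hu hr hs ht)
      have := hW hwW
      simp only [Finset.coe_insert, Set.mem_insert_iff] at this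
      exact this.resolve_left hwv
    obtain ⟨C₂, hC₂⟩ := ih (C₁ • W) hsub
    exact ⟨C₂ * C₁, fun w => by rw [mul_smul]; exact hC₂ w⟩

end Global

/-! ### The theorem -/

section NumberField

variable {K : Type*} [Field K] [NumberField K]

open IsDedekindDomain.HeightOneSpectrum

/-- Local integrality at every finite place implies integrality over `𝓞 K`. [folklore] -/
theorem isIntegral_ringOfIntegers_of_forall_isMinimalAt (W : WeierstrassCurve K)
    (h : ∀ v : HeightOneSpectrum (𝓞 K),
      (W.baseChange (v.adicCompletion K)).IsMinimal (v.adicCompletionIntegers K)) :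
    W.IsIntegral (𝓞 K) := by
  have key : ∀ x : K, (∀ v : HeightOneSpectrum (𝓞 K),
      algebraMap K (v.adicCompletion K) x ∈
        (algebraMap (v.adicCompletionIntegers K) (v.adicCompletion K)).range) →
      ∃ r : 𝓞 K, algebraMap (𝓞 K) K r = x := by
    intro x hx
    have := mem_integers_of_valuation_le_one (R := 𝓞 K) K x fun v => by
      rw [← valued_algebraMap]
      exact (algebraMap_adicCompletionIntegers_range_iff v _).mp (hx v)
    exact this
  have hI := fun v : HeightOneSpectrum (𝓞 K) =>
    IsIntegral.a_mem_range (R := v.adicCompletionIntegers K) (W.baseChange (v.adicCompletion K))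
  apply isIntegral_of_exists_lift
  · exact key _ fun v => by simpa [baseChange] using (hI v).1
  · exact key _ fun v => by simpa [baseChange] using (hI v).2.1
  · exact key _ fun v => by simpa [baseChange] using (hI v).2.2.1
  · exact key _ fun v => by simpa [baseChange] using (hI v).2.2.2.1
  · exact key _ fun v => by simpa [baseChange] using (hI v).2.2.2.2

/-- **Silverman, *AEC* Cor. VIII.8.3**: over a number field of class number one every elliptic
Weierstrass equation has a global minimal model. Discharge of the named fact
`hasGlobalMinimalModel_of_isPrincipalIdealRing`.
[cite: SilvermanAEC2009, VIII.8, Cor. 8.3, p. 213] -/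
theorem hasGlobalMinimalModel_of_isPrincipalIdealRing_holds :
    (hasGlobalMinimalModel_of_isPrincipalIdealRing (K := K)) := by
  intro _ W _
  obtain ⟨C, hC⟩ := exists_variableChange_forall_isMinimalAt
    (finite_setOf_not_isMinimalAt (R := 𝓞 K) W W.Δ'.ne_zero).toFinset W (by simp)
  exact ⟨C, ⟨isIntegral_ringOfIntegers_of_forall_isMinimalAt _ hC, hC⟩⟩

/-- **Silverman, *AEC* Cor. VIII.8.3 for `K = ℚ`** (Néron 1964): every elliptic Weierstrass
equation over `ℚ` has a global minimal model, since `𝓞 ℚ ≃ ℤ` is a principal ideal ring.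
Discharge of the named fact `hasGlobalMinimalModel_rat`.
[cite: SilvermanAEC2009, VIII.8, Cor. 8.3, p. 213] -/
theorem hasGlobalMinimalModel_rat_holds : hasGlobalMinimalModel_rat := by
  intro W _
  haveI : IsPrincipalIdealRing (𝓞 ℚ) := IsPrincipalIdealRing.of_surjective
    Rat.ringOfIntegersEquiv.symm Rat.ringOfIntegersEquiv.symm.surjective
  exact hasGlobalMinimalModel_of_isPrincipalIdealRing_holds W

/-- **The minimal discriminant over `ℚ` is well defined**: two globally minimal models differ by
`u = ±1` (`isGloballyMinimal_unique_holds`, Silverman VII.1.3(b)) and `Δ` scales by `u⁻¹²`.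
Discharge of the named fact `minimalDiscriminantInt_smul_eq`.
[cite: SilvermanAEC2009, VIII.8, remark after Cor. 8.3, p. 213] -/
theorem minimalDiscriminantInt_smul_eq_holds : minimalDiscriminantInt_smul_eq := by
  intro W _ _ C _
  have hu : ((C.u⁻¹ : ℚˣ) : ℚ) ^ 12 = 1 := by
    rcases (isGloballyMinimal_unique_holds W C).1 with h | h <;> norm_num [h]
  apply Int.cast_injective (α := ℚ)
  rw [cast_minimalDiscriminantInt, cast_minimalDiscriminantInt, variableChange_Δ, hu, one_mul]

end NumberField

end WeierstrassCurve

end
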